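import Summits.Ventures.Crystal3D.Theorems.StickyWulffConstantNoReconstructionGainCubeCap
import HarnessLib

/-!
# Four contacts in the `45°` cap are a rigid square, leaving at most four in the thin band

HONEST FRAMING. Part of the venture `Summits/Ventures/Crystal3D` (cell `crystal3d-full`), helper
lemmas `--supports` the crux `NoReconstructionGain` (stmt-Ventures-19144, route
`route-Ventures-StickyWulffConstant`): the RIGIDITY step behind the steep-or-flat layer bound for
the cube facet `(100)`.  Unit vectors of `ℝ³` pairwise at inner product `≤ 1/2`, a unit axis `e`:

* `cap45_four_cross` — four of them with `⟪u, e⟫ ≤ −√2/2` are forced to `⟪u, e⟫ = −√2/2`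
  exactly, with components orthogonal to `e` along a cross `(√2/2)(cos (t + kπ/2), sin (t + kπ/2))`
  (sorted arguments differ by exactly `π/2`, `four_sorted_angles_cross`; orthogonal consecutive
  pairs force `z z' ≤ 1/2`, i.e. `z = z' = −√2/2`) — the square hollow of a `(100)` layer.
* `card_flat_le_four_of_cap45_four` (and the mirror `…'`) — given such a square below (above) a
  ball, at most FOUR further unit vectors `g` with `|⟪g, e⟫| ≤ 1/20` are `≥ 60°` from the four
  and from each other: in the cross frame `13/20 ≤ |a|, |b| ≤ √2/2 + 1/20`
  (`cross_box_bounds`), and two with the same sign pattern would be at distance `< 1`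
  (`sq_sub_le_of_same_box`, `sq_add_sq_rotate`); pigeonhole on the four sign patterns.
  This is the `(100)` analogue of "three in the `35°` cone": a ball of a square-layered film
  with its four lower partners in place has at most four in-plane partners.

WHAT THIS IS NOT: nothing about packings or crystallization by itself; rung F-C1 not moved.
-/

noncomputable section

namespace Summit.Ventures.Crystal3D.Theorems

open Finset Real
open Literature.Geometry.DiscreteGeometry (exists_orthonormalBasis_third_eq_unit)
open scoped InnerProductSpace

open Literature.Geometry.DiscreteGeometry (inner_eq_sum_three) in
/-- **Rigidity of four in the `45°` cap.**  For a unit vector `e`, an orthonormal frame `b` with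
`b 2 = e`, and unit vectors `u₀, …, u₃` with `⟪uₖ, e⟫ ≤ −√2/2` and pairwise inner products
`≤ 1/2`: after a relabelling `σ`, `⟪e, u_{σ k}⟫ = −√2/2` exactly and the frame coordinates of the
`u_{σ k}` are the cross `(√2/2)(cos (t + kπ/2), sin (t + kπ/2), −1)` for some angle `t`.
(Horizontal parts are pairwise non-acute, hence sorted arguments differ by exactly `π/2`;
orthogonal consecutive pairs force `z z' ≤ 1/2`, i.e. `z = z' = −√2/2`.) -/
theorem cap45_four_cross (e : EuclideanSpace ℝ (Fin 3)) (he : ‖e‖ = 1)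
    (b : OrthonormalBasis (Fin 3) ℝ (EuclideanSpace ℝ (Fin 3))) (hb : b 2 = e)
    (u : Fin 4 → EuclideanSpace ℝ (Fin 3)) (hn : ∀ k, ‖u k‖ = 1)
    (hz : ∀ k, ⟪u k, e⟫_ℝ ≤ -(Real.sqrt 2 / 2))
    (hsep : ∀ i j, i ≠ j → ⟪u i, u j⟫_ℝ ≤ 1 / 2) :
    ∃ (t : ℝ) (σ : Fin 4 → Fin 4),
      (∀ k, ⟪b 2, u (σ k)⟫_ℝ = -(Real.sqrt 2 / 2)) ∧
      ⟪b 0, u (σ 0)⟫_ℝ = Real.sqrt 2 / 2 * cos t ∧ ⟪b 1, u (σ 0)⟫_ℝ = Real.sqrt 2 / 2 * sin t ∧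
      ⟪b 0, u (σ 1)⟫_ℝ = -(Real.sqrt 2 / 2 * sin t) ∧ ⟪b 1, u (σ 1)⟫_ℝ = Real.sqrt 2 / 2 * cos t ∧
      ⟪b 0, u (σ 2)⟫_ℝ = -(Real.sqrt 2 / 2 * cos t) ∧ ⟪b 1, u (σ 2)⟫_ℝ = -(Real.sqrt 2 / 2 * sin t) ∧
      ⟪b 0, u (σ 3)⟫_ℝ = Real.sqrt 2 / 2 * sin t ∧ ⟪b 1, u (σ 3)⟫_ℝ = -(Real.sqrt 2 / 2 * cos t) := by
  classical
  have _he := he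
  set c : ℝ := Real.sqrt 2 / 2 with hcdef
  have hc2 : c ^ 2 = 1 / 2 := by
    rw [hcdef, div_pow, Real.sq_sqrt (by norm_num)]; norm_num
  have hcpos : 0 < c := by rw [hcdef]; positivity
  -- coordinates of the four cap vectors
  set X : Fin 4 → ℝ := fun k => ⟪b 0, u k⟫_ℝ with hXdef
  set Y : Fin 4 → ℝ := fun k => ⟪b 1, u k⟫_ℝ with hYdef
  set Z : Fin 4 → ℝ := fun k => ⟪b 2, u k⟫_ℝ with hZdef
  have hZ : ∀ k, Z k ≤ -c := fun k => by
    simp only [hZdef, hb]; rw [real_inner_comm]; exact hz k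
  have hcZ : ∀ k, c * c ≤ -(c * Z k) := fun k => by
    have := mul_le_mul_of_nonneg_left (hZ k) hcpos.le
    linarith
  have hZZ : ∀ k l, 1 / 2 ≤ Z k * Z l := fun k l => by
    have h1 : 0 ≤ (-(Z k) - c) * (-(Z l) - c) :=
      mul_nonneg (by linarith [hZ k]) (by linarith [hZ l])
    have h2 : c * c = 1 / 2 := by rw [← sq, hc2]
    nlinarith [hcZ k, hcZ l]
  have hXYZ : ∀ k, X k ^ 2 + Y k ^ 2 + Z k ^ 2 = 1 := by
    intro k
    have h1 : ⟪u k, u k⟫_ℝ = 1 := by rw [real_inner_self_eq_norm_sq, hn k]; norm_num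
    rw [inner_eq_sum_three b] at h1
    simp only [hXdef, hYdef, hZdef]; linarith [h1]
  have hinner : ∀ i j, ⟪u i, u j⟫_ℝ = X i * X j + Y i * Y j + Z i * Z j := fun i j => by
    rw [inner_eq_sum_three b]
  set w : Fin 4 → ℂ := fun k => ⟨X k, Y k⟩ with hw
  have hwne : ∀ k, w k ≠ 0 := by
    intro k h0
    have hX0 : X k = 0 := by have := congrArg Complex.re h0; simpa [hw] using this
    have hY0 : Y k = 0 := by have := congrArg Complex.im h0; simpa [hw] using this
    obtain ⟨l, hl⟩ : ∃ l : Fin 4, l ≠ k := ⟨k + 1, by simp⟩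
    have h := hsep k l (Ne.symm hl)
    rw [hinner, hX0, hY0, zero_mul, zero_mul, zero_add, zero_add] at h
    have hZk : Z k ^ 2 = 1 := by have := hXYZ k; rw [hX0, hY0] at this; linarith
    have hZk' : Z k = -1 := by
      have hf : (Z k + 1) * (Z k - 1) = 0 := by nlinarith [hZk]
      rcases mul_eq_zero.1 hf with h1 | h1
      · linarith
      · linarith [hZ k]
    rw [hZk'] at h
    have hchalf : 1 / 2 < c := by nlinarith [hc2, hcpos]
    linarith [hZ l]
  -- polar form and the sorted cross
  set ρ : Fin 4 → ℝ := fun k => ‖w k‖ with hρdef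
  set θ : Fin 4 → ℝ := fun k => Complex.arg (w k) with hθdef
  have hre : ∀ k, X k = ρ k * cos (θ k) := fun k => (Complex.norm_mul_cos_arg (w k)).symm
  have him : ∀ k, Y k = ρ k * sin (θ k) := fun k => (Complex.norm_mul_sin_arg (w k)).symm
  have hρ0 : ∀ k, 0 < ρ k := fun k => norm_pos_iff.2 (hwne _)
  have hρsq : ∀ k, ρ k ^ 2 = X k ^ 2 + Y k ^ 2 := by
    intro k; simp only [hρdef]; rw [Complex.sq_norm, Complex.normSq_mk]; ring
  have hprod : ∀ i j, X i * X j + Y i * Y j = ρ i * ρ j * cos (θ i - θ j) := by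
    intro i j; rw [hre, hre, him, him, cos_sub]; ring
  have hC : ∀ i j, i ≠ j → cos (θ i - θ j) ≤ 0 := by
    intro i j hij
    have h := hsep i j hij
    rw [hinner, hprod] at h
    by_contra hcc
    have : 0 < ρ i * ρ j * cos (θ i - θ j) := mul_pos (mul_pos (hρ0 i) (hρ0 j)) (not_le.1 hcc)
    linarith [hZZ i j]
  have hθinj : Function.Injective θ := by
    intro i j hij
    by_contra hne
    have h := hC i j hne
    rw [hij, sub_self, Real.cos_zero] at h
    linarith
  have hAcard : (Finset.univ.image θ).card = 4 := by
    rw [Finset.card_image_of_injective _ hθinj, Finset.card_univ, Fintype.card_fin]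
  let emb := (Finset.univ.image θ).orderEmbOfFin hAcard
  have hmem : ∀ k, ∃ i, θ i = emb k := by
    intro k
    have := (Finset.univ.image θ).orderEmbOfFin_mem hAcard k
    rw [Finset.mem_image] at this
    obtain ⟨i, -, hi⟩ := this
    exact ⟨i, hi⟩
  choose π' hπ' using hmem
  have hπne : ∀ k l, k ≠ l → π' k ≠ π' l := by
    intro k l hkl h
    apply hkl; apply emb.injective; rw [← hπ' k, ← hπ' l, h]
  obtain ⟨h01, h12, h23⟩ := four_sorted_angles_cross (fun k => emb k) emb.strictMono
    (by show -π < emb 0; rw [← hπ' 0]; exact Complex.neg_pi_lt_arg _)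
    (by show emb 3 ≤ π; rw [← hπ' 3]; exact Complex.arg_le_pi _)
    (by
      intro i j hij
      rw [← hπ' i, ← hπ' j]
      exact hC _ _ (hπne i j hij))
  set t : ℝ := emb 0 with ht
  have hθ0 : θ (π' 0) = t := hπ' 0
  have hθ1 : θ (π' 1) = t + π / 2 := by rw [hπ' 1]; simp only [ht] at h01 ⊢; linarith
  have hθ2 : θ (π' 2) = t + π := by rw [hπ' 2]; simp only [ht] at h01 h12 ⊢; linarith
  have hθ3 : θ (π' 3) = t + π + π / 2 := by
    rw [hπ' 3]; simp only [ht] at h01 h12 h23 ⊢; linarith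
  -- orthogonal consecutive pairs force the heights `Z = -c`
  have horth : ∀ k l, cos (θ (π' k) - θ (π' l)) = 0 → Z (π' k) = -c ∧ Z (π' l) = -c := by
    intro k l h0
    have hkl : π' k ≠ π' l := by
      intro he'
      rw [he', sub_self, Real.cos_zero] at h0; exact one_ne_zero h0
    have h := hsep (π' k) (π' l) hkl
    rw [hinner, hprod, h0, mul_zero, zero_add] at h
    -- `Z Z' ≤ 1/2` with `Z, Z' ≤ -c`, `c² = 1/2` forces `Z = Z' = -c`
    have ha : 0 ≤ -(Z (π' k)) - c := by linarith [hZ (π' k)]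
    have hb' : 0 ≤ -(Z (π' l)) - c := by linarith [hZ (π' l)]
    have hcc : c * c = 1 / 2 := by rw [← sq, hc2]
    have hk1 : c * (-(Z (π' k)) - c) ≤ 0 := by
      have := mul_le_mul_of_nonneg_left (show c ≤ -(Z (π' l)) by linarith [hZ (π' l)]) ha
      nlinarith [hcZ (π' k)]
    have hl1 : c * (-(Z (π' l)) - c) ≤ 0 := by
      have := mul_le_mul_of_nonneg_left (show c ≤ -(Z (π' k)) by linarith [hZ (π' k)]) hb'
      nlinarith [hcZ (π' l)]
    have hk2 : -(Z (π' k)) - c ≤ 0 := nonpos_of_mul_nonpos_right hk1 hcpos |> fun h => by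
      simpa using h
    have hl2 : -(Z (π' l)) - c ≤ 0 := nonpos_of_mul_nonpos_right hl1 hcpos |> fun h => by
      simpa using h
    constructor <;> linarith
  have hZ0 : Z (π' 0) = -c ∧ Z (π' 1) = -c :=
    horth 0 1 (by rw [hθ0, hθ1, show t - (t + π / 2) = -(π / 2) by ring, Real.cos_neg,
      Real.cos_pi_div_two])
  have hZ2 : Z (π' 2) = -c ∧ Z (π' 3) = -c :=
    horth 2 3 (by rw [hθ2, hθ3, show t + π - (t + π + π / 2) = -(π / 2) by ring, Real.cos_neg,
      Real.cos_pi_div_two])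
  have hρc : ∀ k, Z (π' k) = -c → ρ (π' k) = c := by
    intro k hk
    have h0 := hXYZ (π' k)
    rw [hk, neg_sq, hc2] at h0
    have h1 : ρ (π' k) ^ 2 = c ^ 2 := by rw [hρsq, hc2]; linarith
    exact (pow_left_inj₀ (hρ0 _).le hcpos.le two_ne_zero).1 h1
  refine ⟨t, π', ?_, ?_, ?_, ?_, ?_, ?_, ?_, ?_, ?_⟩
  · intro k
    fin_cases k
    · exact hZ0.1
    · exact hZ0.2
    · exact hZ2.1
    · exact hZ2.2
  · show X (π' 0) = c * cos t
    rw [hre, hρc 0 hZ0.1, hθ0]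
  · show Y (π' 0) = c * sin t
    rw [him, hρc 0 hZ0.1, hθ0]
  · show X (π' 1) = -(c * sin t)
    rw [hre, hρc 1 hZ0.2, hθ1, Real.cos_add_pi_div_two]; ring
  · show Y (π' 1) = c * cos t
    rw [him, hρc 1 hZ0.2, hθ1, Real.sin_add_pi_div_two]
  · show X (π' 2) = -(c * cos t)
    rw [hre, hρc 2 hZ2.1, hθ2, Real.cos_add_pi]; ring
  · show Y (π' 2) = -(c * sin t)
    rw [him, hρc 2 hZ2.1, hθ2, Real.sin_add_pi]; ring
  · show X (π' 3) = c * sin t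
    rw [hre, hρc 3 hZ2.2, hθ3, Real.cos_add_pi_div_two, Real.sin_add_pi]; ring
  · show Y (π' 3) = -(c * cos t)
    rw [him, hρc 3 hZ2.2, hθ3, Real.sin_add_pi_div_two, Real.cos_add_pi]; ring

/-- Arithmetic of the cross frame: a unit vector `(x, y, z)` with `|z| ≤ 1/20` at inner product
`≤ 1/2` with the four cross vectors `(√2/2)(±cos t, ±sin t, −1)` (resp. the rotated ones) has
rotated horizontal coordinates `a = x cos t + y sin t`, `b = −x sin t + y cos t` with
`13/20 ≤ |a|, |b| ≤ √2/2 + 1/20`. -/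
theorem cross_box_bounds {c x y z t : ℝ} (hc2 : c ^ 2 = 1 / 2) (hcpos : 0 < c)
    (hg1 : x * x + y * y + z * z = 1) (hz : |z| ≤ 1 / 20)
    (h0 : x * (c * cos t) + y * (c * sin t) + z * -c ≤ 1 / 2)
    (h1 : x * -(c * sin t) + y * (c * cos t) + z * -c ≤ 1 / 2)
    (h2 : x * -(c * cos t) + y * -(c * sin t) + z * -c ≤ 1 / 2)
    (h3 : x * (c * sin t) + y * -(c * cos t) + z * -c ≤ 1 / 2) :
    |x * cos t + y * sin t| ≤ c + 1 / 20 ∧ |-(x * sin t) + y * cos t| ≤ c + 1 / 20 ∧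
      13 / 20 ≤ |x * cos t + y * sin t| ∧ 13 / 20 ≤ |-(x * sin t) + y * cos t| := by
  have hcs : cos t ^ 2 + sin t ^ 2 = 1 := Real.cos_sq_add_sin_sq t
  have hcup : c ≤ 7072 / 10000 := by
    have h1 : c ^ 2 ≤ (7072 / 10000 : ℝ) ^ 2 := by rw [hc2]; norm_num
    exact (pow_le_pow_iff_left₀ hcpos.le (by norm_num) two_ne_zero).1 h1
  have hgz' := abs_le.1 hz
  have hcc : (1 : ℝ) / 2 = c * c := by rw [← sq, hc2]
  have hA1 : c * (x * cos t + y * sin t) ≤ c * (c + z) := by linarith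
  have hA2 : c * -(x * cos t + y * sin t) ≤ c * (c + z) := by linarith
  have hB1 : c * (-(x * sin t) + y * cos t) ≤ c * (c + z) := by linarith
  have hB2 : c * -(-(x * sin t) + y * cos t) ≤ c * (c + z) := by linarith
  have hA1' := (mul_le_mul_iff_of_pos_left hcpos).1 hA1
  have hA2' := (mul_le_mul_iff_of_pos_left hcpos).1 hA2
  have hB1' := (mul_le_mul_iff_of_pos_left hcpos).1 hB1
  have hB2' := (mul_le_mul_iff_of_pos_left hcpos).1 hB2
  have hAle : |x * cos t + y * sin t| ≤ c + 1 / 20 := by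
    rw [abs_le]; constructor <;> linarith [hgz'.1, hgz'.2]
  have hBle : |-(x * sin t) + y * cos t| ≤ c + 1 / 20 := by
    rw [abs_le]; constructor <;> linarith [hgz'.1, hgz'.2]
  have hAB : (x * cos t + y * sin t) ^ 2 + (-(x * sin t) + y * cos t) ^ 2 = x ^ 2 + y ^ 2 := by
    linear_combination (x ^ 2 + y ^ 2) * hcs
  have hz2 : z ^ 2 ≤ (1 / 20) ^ 2 := by
    rw [← sq_abs]; exact pow_le_pow_left₀ (abs_nonneg _) hz 2
  have hxy : 399 / 400 ≤ x ^ 2 + y ^ 2 := by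
    have : x ^ 2 + y ^ 2 + z ^ 2 = 1 := by rw [← hg1]; ring
    linarith
  have hA2' : (x * cos t + y * sin t) ^ 2 ≤ (c + 1 / 20) ^ 2 := by
    rw [← sq_abs]; exact pow_le_pow_left₀ (abs_nonneg _) hAle 2
  have hB2' : (-(x * sin t) + y * cos t) ^ 2 ≤ (c + 1 / 20) ^ 2 := by
    rw [← sq_abs]; exact pow_le_pow_left₀ (abs_nonneg _) hBle 2
  have hcsq : (c + 1 / 20) ^ 2 ≤ 575 / 1000 := by
    have e : (c + 1 / 20) ^ 2 = c ^ 2 + c / 10 + 1 / 400 := by ring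
    rw [e, hc2]; linarith
  have hAsq : (13 / 20 : ℝ) ^ 2 ≤ |x * cos t + y * sin t| ^ 2 := by rw [sq_abs]; linarith
  have hBsq : (13 / 20 : ℝ) ^ 2 ≤ |-(x * sin t) + y * cos t| ^ 2 := by rw [sq_abs]; linarith
  have hAlo : 13 / 20 ≤ |x * cos t + y * sin t| :=
    (pow_le_pow_iff_left₀ (by norm_num) (abs_nonneg _) two_ne_zero).1 hAsq
  have hBlo : 13 / 20 ≤ |-(x * sin t) + y * cos t| :=
    (pow_le_pow_iff_left₀ (by norm_num) (abs_nonneg _) two_ne_zero).1 hBsq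
  exact ⟨hAle, hBle, hAlo, hBlo⟩

/-- Two numbers of the same sign in the box `13/20 ≤ |·| ≤ c + 1/20` (`c ≤ 0.7072`) differ by less
than `1/5`. -/
theorem sq_sub_le_of_same_box {c p q : ℝ} (hcup : c ≤ 7072 / 10000)
    (hp : |p| ≤ c + 1 / 20) (hq : |q| ≤ c + 1 / 20) (hp' : 13 / 20 ≤ |p|) (hq' : 13 / 20 ≤ |q|)
    (hpq : 0 < p ↔ 0 < q) : (p - q) ^ 2 ≤ 1 / 25 := by
  have hp1 := abs_le.1 hp; have hq1 := abs_le.1 hq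
  rw [show (1 : ℝ) / 25 = (1 / 5) ^ 2 by norm_num]
  rcases lt_or_ge 0 p with hpos | hnp
  · have hpos' : 0 < q := hpq.1 hpos
    rw [abs_of_pos hpos] at hp'; rw [abs_of_pos hpos'] at hq'
    exact sq_le_sq' (by linarith) (by linarith)
  · have hnp' : q ≤ 0 := by
      by_contra h'; exact absurd (hpq.2 (not_le.1 h')) (not_lt.2 hnp)
    rw [abs_of_nonpos hnp] at hp'; rw [abs_of_nonpos hnp'] at hq'
    exact sq_le_sq' (by linarith) (by linarith)

/-- The rotated frame is isometric: squared horizontal distance is the same in the coordinates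
`(a, b) = (x cos t + y sin t, −x sin t + y cos t)`. -/
theorem sq_add_sq_rotate (x y x' y' t : ℝ) :
    (x - x') ^ 2 + (y - y') ^ 2 =
      (x * cos t + y * sin t - (x' * cos t + y' * sin t)) ^ 2 +
        (-(x * sin t) + y * cos t - (-(x' * sin t) + y' * cos t)) ^ 2 := by
  linear_combination (-((x - x') ^ 2 + (y - y') ^ 2)) * Real.cos_sq_add_sin_sq t

open Literature.Geometry.DiscreteGeometry (inner_eq_sum_three) in
/-- **Four in the `45°` cap leave room for at most four in the thin band.**  Let `e` be a unit
vector and `u₀, …, u₃` unit vectors with `⟪uₖ, e⟫ ≤ −√2/2` and pairwise inner products `≤ 1/2`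
(so a rigid square, `cap45_four_cross`).  A finite set `G` of unit vectors with
`|⟪g, e⟫| ≤ 1/20`, each at inner product `≤ 1/2` with every `uₖ` and with every other element
of `G`, has at most FOUR elements: in the cross frame each `g` has horizontal coordinates
`|A|, |B| ∈ [13/20, √2/2 + 1/20]`, and two elements with the same sign pattern would be at
distance `< 1`. -/
theorem card_flat_le_four_of_cap45_four (e : EuclideanSpace ℝ (Fin 3)) (he : ‖e‖ = 1)
    (u : Fin 4 → EuclideanSpace ℝ (Fin 3)) (hn : ∀ k, ‖u k‖ = 1)
    (hz : ∀ k, ⟪u k, e⟫_ℝ ≤ -(Real.sqrt 2 / 2))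
    (hsep : ∀ i j, i ≠ j → ⟪u i, u j⟫_ℝ ≤ 1 / 2)
    {G : Finset (EuclideanSpace ℝ (Fin 3))} (hGn : ∀ g ∈ G, ‖g‖ = 1)
    (hGz : ∀ g ∈ G, |⟪g, e⟫_ℝ| ≤ 1 / 20) (hGu : ∀ g ∈ G, ∀ k, ⟪g, u k⟫_ℝ ≤ 1 / 2)
    (hGsep : ∀ g ∈ G, ∀ g' ∈ G, g ≠ g' → ⟪g, g'⟫_ℝ ≤ 1 / 2) : G.card ≤ 4 := by
  classical
  obtain ⟨b, hb⟩ := exists_orthonormalBasis_third_eq_unit he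
  obtain ⟨t, σ, hZσ, hX0, hY0, hX1, hY1, hX2, hY2, hX3, hY3⟩ :=
    cap45_four_cross e he b hb u hn hz hsep
  set c : ℝ := Real.sqrt 2 / 2 with hcdef
  have hc2 : c ^ 2 = 1 / 2 := by
    rw [hcdef, div_pow, Real.sq_sqrt (by norm_num)]; norm_num
  have hcpos : 0 < c := by rw [hcdef]; positivity
  have hcup : c ≤ 7072 / 10000 := by
    have h1 : c ^ 2 ≤ (7072 / 10000 : ℝ) ^ 2 := by rw [hc2]; norm_num
    exact (pow_le_pow_iff_left₀ hcpos.le (by norm_num) two_ne_zero).1 h1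
  -- boxes for the flat vectors in the cross frame `a = x cos t + y sin t`, `b' = -x sin t + y cos t`
  have hbox : ∀ g ∈ G,
      |⟪b 0, g⟫_ℝ * cos t + ⟪b 1, g⟫_ℝ * sin t| ≤ c + 1 / 20 ∧
      |-(⟪b 0, g⟫_ℝ * sin t) + ⟪b 1, g⟫_ℝ * cos t| ≤ c + 1 / 20 ∧
      13 / 20 ≤ |⟪b 0, g⟫_ℝ * cos t + ⟪b 1, g⟫_ℝ * sin t| ∧
      13 / 20 ≤ |-(⟪b 0, g⟫_ℝ * sin t) + ⟪b 1, g⟫_ℝ * cos t| ∧ |⟪b 2, g⟫_ℝ| ≤ 1 / 20 := by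
    intro g hg
    have hgz : |⟪b 2, g⟫_ℝ| ≤ 1 / 20 := by rw [hb, real_inner_comm]; exact hGz g hg
    have hk : ∀ k, ⟪b 0, g⟫_ℝ * ⟪b 0, u (σ k)⟫_ℝ + ⟪b 1, g⟫_ℝ * ⟪b 1, u (σ k)⟫_ℝ +
        ⟪b 2, g⟫_ℝ * ⟪b 2, u (σ k)⟫_ℝ ≤ 1 / 2 := by
      intro k
      have := hGu g hg (σ k)
      rw [inner_eq_sum_three b] at this
      exact this
    have h0 := hk 0; rw [hX0, hY0, hZσ 0] at h0
    have h1 := hk 1; rw [hX1, hY1, hZσ 1] at h1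
    have h2 := hk 2; rw [hX2, hY2, hZσ 2] at h2
    have h3 := hk 3; rw [hX3, hY3, hZσ 3] at h3
    have hg1 : ⟪g, g⟫_ℝ = 1 := by rw [real_inner_self_eq_norm_sq, hGn g hg]; norm_num
    rw [inner_eq_sum_three b] at hg1
    obtain ⟨hAle, hBle, hAlo, hBlo⟩ := cross_box_bounds hc2 hcpos hg1 hgz h0 h1 h2 h3
    exact ⟨hAle, hBle, hAlo, hBlo, hgz⟩
  -- two flat vectors with the same sign pattern are too close
  have hclose : ∀ g ∈ G, ∀ g' ∈ G,
      (0 < ⟪b 0, g⟫_ℝ * cos t + ⟪b 1, g⟫_ℝ * sin t ↔ 0 < ⟪b 0, g'⟫_ℝ * cos t + ⟪b 1, g'⟫_ℝ * sin t) →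
      (0 < -(⟪b 0, g⟫_ℝ * sin t) + ⟪b 1, g⟫_ℝ * cos t ↔
        0 < -(⟪b 0, g'⟫_ℝ * sin t) + ⟪b 1, g'⟫_ℝ * cos t) →
      ‖g - g'‖ ^ 2 < 1 := by
    intro g hg g' hg' hAA hBB
    obtain ⟨hA1, hB1, hA2, hB2, hz1⟩ := hbox g hg
    obtain ⟨hA1', hB1', hA2', hB2', hz1'⟩ := hbox g' hg'
    have hnormsq : ‖g - g'‖ ^ 2 = (⟪b 0, g⟫_ℝ - ⟪b 0, g'⟫_ℝ) ^ 2 + (⟪b 1, g⟫_ℝ - ⟪b 1, g'⟫_ℝ) ^ 2 +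
        (⟪b 2, g⟫_ℝ - ⟪b 2, g'⟫_ℝ) ^ 2 := by
      rw [← real_inner_self_eq_norm_sq, inner_eq_sum_three b, inner_sub_right, inner_sub_right,
        inner_sub_right]
      ring
    have hdA := sq_sub_le_of_same_box hcup hA1 hA1' hA2 hA2' hAA
    have hdB := sq_sub_le_of_same_box hcup hB1 hB1' hB2 hB2' hBB
    rw [hnormsq]
    generalize ⟪b 0, g⟫_ℝ = x at hdA hdB ⊢
    generalize ⟪b 1, g⟫_ℝ = y at hdA hdB ⊢
    generalize ⟪b 2, g⟫_ℝ = z at hz1 ⊢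
    generalize ⟪b 0, g'⟫_ℝ = x' at hdA hdB ⊢
    generalize ⟪b 1, g'⟫_ℝ = y' at hdA hdB ⊢
    generalize ⟪b 2, g'⟫_ℝ = z' at hz1' ⊢
    have hrot := sq_add_sq_rotate x y x' y' t
    have hz := abs_le.1 hz1; have hz' := abs_le.1 hz1'
    have hzz : (z - z') ^ 2 ≤ 1 / 100 := by
      rw [show (1 : ℝ) / 100 = (1 / 10) ^ 2 by norm_num]
      exact sq_le_sq' (by linarith [hz.1, hz'.2]) (by linarith [hz.2, hz'.1])
    rw [hrot]; linarith
  -- but two distinct flat vectors are at distance `≥ 1`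
  have hfar : ∀ g ∈ G, ∀ g' ∈ G, g ≠ g' → 1 ≤ ‖g - g'‖ ^ 2 := by
    intro g hg g' hg' hne
    rw [norm_sub_sq_real, hGn g hg, hGn g' hg']
    linarith [hGsep g hg g' hg' hne]
  -- pigeonhole on the four sign patterns
  by_contra hG
  obtain ⟨G', hG', hcard⟩ := Finset.exists_subset_card_eq (show 5 ≤ G.card by omega)
  set eqv := (Finset.equivFinOfCardEq hcard).symm with heqv
  set g : Fin 5 → EuclideanSpace ℝ (Fin 3) := fun k => ((eqv k : G') : EuclideanSpace ℝ (Fin 3))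
    with hgdef
  have hgG : ∀ k, g k ∈ G := fun k => hG' (eqv k).2
  have hginj : Function.Injective g := fun i j h => eqv.injective (Subtype.val_injective h)
  set sgn : Fin 5 → Bool × Bool := fun k =>
    (decide (0 < ⟪b 0, g k⟫_ℝ * cos t + ⟪b 1, g k⟫_ℝ * sin t),
      decide (0 < -(⟪b 0, g k⟫_ℝ * sin t) + ⟪b 1, g k⟫_ℝ * cos t)) with hsgn
  obtain ⟨i, j, hij, hsg⟩ := Fintype.exists_ne_map_eq_of_card_lt sgn (by simp)
  have hne : g i ≠ g j := fun h => hij (hginj h)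
  simp only [hsgn, Prod.mk.injEq, decide_eq_decide] at hsg
  have h1 := hclose (g i) (hgG i) (g j) (hgG j) hsg.1 hsg.2
  have h2 := hfar (g i) (hgG i) (g j) (hgG j) hne
  linarith

/-- The mirrored square lemma: four partners in the cap `⟪u, e⟫ ≥ √2/2` also force at most four
in the thin band. -/
theorem card_flat_le_four_of_cap45_four' (e : EuclideanSpace ℝ (Fin 3)) (he : ‖e‖ = 1)
    (u : Fin 4 → EuclideanSpace ℝ (Fin 3)) (hn : ∀ k, ‖u k‖ = 1)
    (hz : ∀ k, Real.sqrt 2 / 2 ≤ ⟪u k, e⟫_ℝ)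
    (hsep : ∀ i j, i ≠ j → ⟪u i, u j⟫_ℝ ≤ 1 / 2)
    {G : Finset (EuclideanSpace ℝ (Fin 3))} (hGn : ∀ g ∈ G, ‖g‖ = 1)
    (hGz : ∀ g ∈ G, |⟪g, e⟫_ℝ| ≤ 1 / 20) (hGu : ∀ g ∈ G, ∀ k, ⟪g, u k⟫_ℝ ≤ 1 / 2)
    (hGsep : ∀ g ∈ G, ∀ g' ∈ G, g ≠ g' → ⟪g, g'⟫_ℝ ≤ 1 / 2) : G.card ≤ 4 := by
  refine card_flat_le_four_of_cap45_four (-e) (by rw [norm_neg, he]) u hn (fun k => ?_) hsep hGn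
    (fun g hg => ?_) hGu hGsep
  · rw [inner_neg_right]; linarith [hz k]
  · rw [inner_neg_right, abs_neg]; exact hGz g hg


end Summit.Ventures.Crystal3D.Theorems

end
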